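import Mathlib
import Literature.NumberTheory.Transcendental.KZLogCalculusProofs
import Literature.NumberTheory.Transcendental.SemialgebraicMapsProofs
import Literature.NumberTheory.Transcendental.KZDilationMove

/-!
# `TateLifting` (stmt-KontsevichZagierPeriods-9129), line `Sketch` — stub `stub_sqrtSubst`

THE SQUARE SUBSTITUTION in the Kontsevich–Zagier calculus (rule (2) of §1.2 with `Φ(t) = t²` on
`t > 0`). For a one-dimensional representation `r = [σ, f]` whose domain lies in the half-line
`σ ⊆ (0, ∞)`, the pulled-back representation `r' = [D', 2t·f(t²)]` on
`D' = {t > 0 | t² ∈ σ} = (0,∞) ∩ Φ⁻¹(σ)` is honest: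

* `D'` is `ℚ`-semialgebraic — the preimage of `σ` under the polynomial map `Φ = (X₀²)`
  (`IsSemialgebraic.preimage_aeval`) cut by `0 < X₀` (`SqrtSubst.sq_isSemialgebraic`);
* `t ↦ 2t·f(t²)` is `ℚ`-semialgebraic on `D'` — the polynomial `2X₀` times the composite `f ∘ Φ`
  (`IsSemialgebraicFunOn.comp_isSemialgebraicMapOn_holds`, `IsSemialgebraicFunOn.mul_holds`;
  `SqrtSubst.sq_isSemialgebraicFunOn`);
* it is absolutely integrable on `D'` — Mathlib's Jacobian criterion
  `MeasureTheory.integrableOn_image_iff_integrableOn_abs_det_fderiv_smul` along `Φ`, which maps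
  `D'` injectively ONTO `σ` (`x = Φ(√x)` for `x > 0`, `SqrtSubst.sq_image`) with
  `Φ'(t) = (2t) • id`, `|det Φ'(t)| = 2t` (`SqrtSubst.sq_integrableOn`).

The same data are the certificate of ONE change-of-variables move (`KZ.changeOfVariablesRel`)
from `r'` to `r`, whence `[σ, f] − [D', 2t·f(t²)] ∈ KZ.relations` (`tateLifting_sqrtSubst`).

References: M. Kontsevich, D. Zagier, *Periods* (2001), §1.2 rule (2); J. Bochnak, M. Coste,
M.-F. Roy, *Real Algebraic Geometry* (1998), §2.2.
-/

noncomputable section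

open MeasureTheory Set
open Literature.NumberTheory.Transcendental
open Literature.ModelTheory.ExponentialFields (IsSemialgebraic isSemialgebraic_setOf_eval_pos)
open MvPolynomial (aeval X C)

namespace Summit.KontsevichZagierPeriods.InverseLandau

namespace SqrtSubst

/-- The square map `Φ(y) = (y₀²)` of `ℝ¹` has derivative `(2y₀) • id` at `y = x`. [folklore] -/
theorem sq_hasFDerivAt (x : Fin 1 → ℝ) :
    HasFDerivAt (fun y : Fin 1 → ℝ => fun _ : Fin 1 => y 0 ^ 2)
      ((2 * x 0) • ContinuousLinearMap.id ℝ (Fin 1 → ℝ)) x := by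
  rw [hasFDerivAt_pi']
  intro i
  obtain rfl : i = 0 := Fin.fin_one_eq_zero i
  have h0 : HasFDerivAt (fun f : Fin 1 → ℝ => f 0)
      (ContinuousLinearMap.proj (R := ℝ) (φ := fun _ : Fin 1 => ℝ) 0) x :=
    hasFDerivAt_apply 0 x
  have h1 : HasDerivAt (fun t : ℝ => t ^ 2) (2 * x 0) (x 0) := by
    simpa using hasDerivAt_pow 2 (x 0)
  refine (h1.comp_hasFDerivAt x h0).congr_fderiv (ContinuousLinearMap.ext fun v => ?_)
  simp

/-- `|det ((2x₀) • id_{ℝ¹})| = 2x₀` for `x₀ > 0`. [folklore] -/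
theorem sq_abs_det {x : Fin 1 → ℝ} (hx : 0 < x 0) :
    |((2 * x 0) • ContinuousLinearMap.id ℝ (Fin 1 → ℝ)).det| = 2 * x 0 := by
  have h2 : 0 < 2 * x 0 := by positivity
  rw [KZ.det_smul_id_fin, pow_one, abs_of_pos h2]

/-- The square map is injective on `D' = {t > 0 | t² ∈ σ}` (`t² = u²`, `t, u > 0 ⟹ t = u`).
[folklore] -/
theorem sq_injOn (σ : Set (Fin 1 → ℝ)) :
    InjOn (fun y : Fin 1 → ℝ => fun _ : Fin 1 => y 0 ^ 2)
      {t : Fin 1 → ℝ | 0 < t 0 ∧ (fun _ : Fin 1 => t 0 ^ 2) ∈ σ} := by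
  intro x hx y hy hxy
  have h0 : x 0 ^ 2 = y 0 ^ 2 := congrFun hxy 0
  have h1 : x 0 = y 0 := (pow_left_inj₀ hx.1.le hy.1.le two_ne_zero).1 h0
  funext i
  obtain rfl : i = 0 := Fin.fin_one_eq_zero i
  exact h1

/-- The square map sends `D' = {t > 0 | t² ∈ σ}` ONTO `σ` when `σ ⊆ (0,∞)`: `x = (√x₀)²`.
[folklore] -/
theorem sq_image {σ : Set (Fin 1 → ℝ)} (hσ : ∀ x ∈ σ, 0 < x 0) :
    (fun y : Fin 1 → ℝ => fun _ : Fin 1 => y 0 ^ 2) ''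
        {t : Fin 1 → ℝ | 0 < t 0 ∧ (fun _ : Fin 1 => t 0 ^ 2) ∈ σ} = σ := by
  ext x
  constructor
  · rintro ⟨t, ht, rfl⟩
    exact ht.2
  · intro hx
    have hx0 : 0 < x 0 := hσ x hx
    have hxe : (fun _ : Fin 1 => √(x 0) ^ 2) = x := by
      funext i
      obtain rfl : i = 0 := Fin.fin_one_eq_zero i
      exact Real.sq_sqrt hx0.le
    refine ⟨fun _ => √(x 0), ⟨Real.sqrt_pos.2 hx0, ?_⟩, hxe⟩
    show (fun _ : Fin 1 => √(x 0) ^ 2) ∈ σ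
    rw [hxe]
    exact hx

/-- `D' = {t > 0 | t² ∈ σ}` is `ℚ`-semialgebraic for `ℚ`-semialgebraic `σ`: the polynomial preimage
`Φ⁻¹(σ)` (`IsSemialgebraic.preimage_aeval`) cut by `0 < X₀`. [folklore] -/
theorem sq_isSemialgebraic {σ : Set (Fin 1 → ℝ)} (hσ : IsSemialgebraic ℚ σ) :
    IsSemialgebraic ℚ {t : Fin 1 → ℝ | 0 < t 0 ∧ (fun _ : Fin 1 => t 0 ^ 2) ∈ σ} := by
  convert (isSemialgebraic_setOf_eval_pos (R := ℝ) (X 0 : MvPolynomial (Fin 1) ℚ)).inter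
    (hσ.preimage_aeval fun _ : Fin 1 => (X 0 ^ 2 : MvPolynomial (Fin 1) ℚ)) using 1
  ext t
  simp

/-- The square map is a `ℚ`-semialgebraic map on every `ℚ`-semialgebraic set (it is polynomial).
[folklore] -/
theorem sq_isSemialgebraicMapOn {s : Set (Fin 1 → ℝ)} (hs : IsSemialgebraic ℚ s) :
    IsSemialgebraicMapOn ℚ s (fun y : Fin 1 → ℝ => fun _ : Fin 1 => y 0 ^ 2) :=
  (isSemialgebraicMapOn_aeval hs fun _ : Fin 1 => (X 0 ^ 2 : MvPolynomial (Fin 1) ℚ)).congr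
    fun y _ => by
      funext j
      simp

/-- The pulled-back integrand `t ↦ 2t₀ · f(t²)` is `ℚ`-semialgebraic on `D'` whenever `f` is
`ℚ`-semialgebraic on `σ`: the polynomial `2X₀` times the composite of `f` with the polynomial map
`Φ`, `Φ(D') ⊆ σ` (Tarski–Seidenberg). [folklore] -/
theorem sq_isSemialgebraicFunOn {σ : Set (Fin 1 → ℝ)} {f : (Fin 1 → ℝ) → ℝ}
    (hσ : IsSemialgebraic ℚ σ) (hf : IsSemialgebraicFunOn ℚ σ f) :
    IsSemialgebraicFunOn ℚ {t : Fin 1 → ℝ | 0 < t 0 ∧ (fun _ : Fin 1 => t 0 ^ 2) ∈ σ}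
      (fun t => 2 * t 0 * f (fun _ => t 0 ^ 2)) := by
  have hD := sq_isSemialgebraic hσ
  have h1 : IsSemialgebraicFunOn ℚ {t : Fin 1 → ℝ | 0 < t 0 ∧ (fun _ : Fin 1 => t 0 ^ 2) ∈ σ}
      (fun t => 2 * t 0) := by
    refine (isSemialgebraicFunOn_aeval hD (C 2 * X 0 : MvPolynomial (Fin 1) ℚ)).congr
      fun t _ => ?_
    simp
  have h2 : IsSemialgebraicFunOn ℚ {t : Fin 1 → ℝ | 0 < t 0 ∧ (fun _ : Fin 1 => t 0 ^ 2) ∈ σ}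
      (f ∘ fun y : Fin 1 → ℝ => fun _ : Fin 1 => y 0 ^ 2) :=
    IsSemialgebraicFunOn.comp_isSemialgebraicMapOn_holds hf (sq_isSemialgebraicMapOn hD)
      fun t ht => ht.2
  exact (IsSemialgebraicFunOn.mul_holds h1 h2).congr fun t _ => rfl

/-- The pulled-back integrand `t ↦ 2t₀ · f(t²)` is absolutely integrable on `D'` as soon as `f` is
on `σ ⊆ (0,∞)`: Mathlib's Jacobian criterion along the square map, which is injective on `D'`
with image `σ` and `|det Φ'(t)| = 2t₀`. [folklore] -/
theorem sq_integrableOn {σ : Set (Fin 1 → ℝ)} {f : (Fin 1 → ℝ) → ℝ} (hσ : IsSemialgebraic ℚ σ)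
    (hpos : ∀ x ∈ σ, 0 < x 0) (hf : IntegrableOn f σ) :
    IntegrableOn (fun t => 2 * t 0 * f (fun _ => t 0 ^ 2))
      {t : Fin 1 → ℝ | 0 < t 0 ∧ (fun _ : Fin 1 => t 0 ^ 2) ∈ σ} := by
  have hDm : MeasurableSet {t : Fin 1 → ℝ | 0 < t 0 ∧ (fun _ : Fin 1 => t 0 ^ 2) ∈ σ} :=
    Literature.ModelTheory.ExponentialFields.IsSemialgebraic.measurableSet_holds
      (sq_isSemialgebraic hσ)
  rw [← sq_image hpos] at hf
  have h := (integrableOn_image_iff_integrableOn_abs_det_fderiv_smul volume hDm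
    (fun t _ => (sq_hasFDerivAt t).hasFDerivWithinAt) (sq_injOn σ) f).1 hf
  refine h.congr_fun (fun t ht => ?_) hDm
  show |((2 * t 0) • ContinuousLinearMap.id ℝ (Fin 1 → ℝ)).det| • f (fun _ => t 0 ^ 2) = _
  rw [sq_abs_det ht.1, smul_eq_mul]

end SqrtSubst

/-- **The square substitution** (stub `stub_sqrtSubst` of the lead's skeleton, the body of
`SqrtSubst`): for a one-dimensional representation `r = [σ, f]` with `σ ⊆ (0,∞)`, the honest
pulled-back representation `r' = [D', 2t·f(t²)]`, `D' = {t > 0 | t² ∈ σ}` (semialgebraic domain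
`SqrtSubst.sq_isSemialgebraic`, semialgebraic integrand `SqrtSubst.sq_isSemialgebraicFunOn`,
absolute convergence `SqrtSubst.sq_integrableOn`), satisfies `[σ, f] − [D', 2t·f(t²)] ∈ KZ.relations`:
ONE change of variables `x = Φ(t) = t²` (Kontsevich–Zagier's rule (2), `KZ.changeOfVariablesRel`)
from `r'` onto `r` — `Φ` is a polynomial (hence `ℚ`-semialgebraic) map, injective on `D'` with
`Φ(D') = σ`, `Φ'(t) = (2t) • id`, and `2t·f(t²) = f(Φ t)·|det Φ'(t)|` on `D'`.
[cite: KontsevichZagier2001, §1.2 rule (2)] -/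
theorem tateLifting_sqrtSubst :
    ∀ r : KZ.IntegralRep 1, (∀ x ∈ r.domain, 0 < x 0) →
      ∃ r' : KZ.IntegralRep 1, r'.domain = {t | 0 < t 0 ∧ (fun _ : Fin 1 => t 0 ^ 2) ∈ r.domain} ∧
        Set.EqOn r'.integrand (fun t => 2 * t 0 * r.integrand (fun _ => t 0 ^ 2)) r'.domain ∧
        KZ.of r - KZ.of r' ∈ KZ.relations := by
  intro r hpos
  refine ⟨⟨{t | 0 < t 0 ∧ (fun _ : Fin 1 => t 0 ^ 2) ∈ r.domain},
    fun t => 2 * t 0 * r.integrand (fun _ => t 0 ^ 2),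
    SqrtSubst.sq_isSemialgebraic r.isSemialgebraic_domain,
    SqrtSubst.sq_isSemialgebraicFunOn r.isSemialgebraic_domain r.isSemialgebraicFunOn_integrand,
    SqrtSubst.sq_integrableOn r.isSemialgebraic_domain hpos r.integrableOn⟩, rfl, fun _ _ => rfl, ?_⟩
  -- ONE change of variables `x = t²` from `r'` onto `r`; `[r] − [r'] = −([r'] − [r])`
  rw [← neg_sub]
  refine KZ.relations.neg_mem (KZ.changeOfVariablesRel_subset_relations
    ⟨1, _, r, fun y : Fin 1 → ℝ => fun _ : Fin 1 => y 0 ^ 2,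
      fun y => (2 * y 0) • ContinuousLinearMap.id ℝ (Fin 1 → ℝ),
      SqrtSubst.sq_isSemialgebraicMapOn (SqrtSubst.sq_isSemialgebraic r.isSemialgebraic_domain),
      fun t _ => (SqrtSubst.sq_hasFDerivAt t).hasFDerivWithinAt, SqrtSubst.sq_injOn r.domain,
      (SqrtSubst.sq_image hpos).symm, fun t ht => ?_, rfl⟩)
  show 2 * t 0 * r.integrand (fun _ => t 0 ^ 2) =
    r.integrand (fun _ => t 0 ^ 2) * |((2 * t 0) • ContinuousLinearMap.id ℝ (Fin 1 → ℝ)).det|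
  rw [SqrtSubst.sq_abs_det ht.1]
  exact mul_comm _ _

end Summit.KontsevichZagierPeriods.InverseLandau

end
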